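import Summits.PneNP.PneNP.Theorems.ChebyshevTracialDesignJuntaPatternLaw
import HarnessLib

/-!
# Junta virtual positivity, part C: the design value of a junta psd pair is `≤ 0`

Support file for the crux `TracialDecayExp20` (stmt-PneNP-19878; also the aside `TracialDecay20`,
stmt-PneNP-19646) of route `ChebyshevTracialDesign` — the cell's LOCAL VIRTUAL POSITIVITY LEMMA (N1)
(HOME/pnp-psdrank-p1/N1-LocalVirtualPositivity.md, Theorem; the planner's BC5 rung `stub_rung_juntaVirtual`
of the crux skeleton HOME/pnp-psdrank-p1/route/births_scratch.lean), kernel-checked: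

for an exact extrapolation design `(C, w)` of degree `D` on the `t`-cuts of `K_n`
(`Literature.Combinatorics.Optimization.IsExactDesign n t T D B C w`) and psd matrix families
`X : OddSet n → Sym_r⁺`, `Y : PMatch n → Sym_r⁺` such that `X_U` depends only on `U ∩ A` for a window `A`
with `|A| ≤ D` (`2|A| ≤ t+2`, `2|A|+t ≤ n+2`; NO condition on `Y`, no tightness, any dimension `r`), the
design value `Σ_U Σ_M levelWeight(U,M)·tr(X_U Y_M)` is `≤ 0` (`sum_levelWeight_trace_nonpos_of_junta`);
in particular for balanced designs of degree `dq n` on levels `≤ Tq n` and `|A| ≤ dq n`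
(`juntaVirtualPositivity_bal`). Mechanism: per matching `M` the level sums are `T(n/2; c, i)·P_M(c)` with
`deg P_M ≤ |A| ≤ D`, `P_M(0) ≥ 0` (junta sum law, part B); `|Q_c| = #PM·T(n/2; c, i)`; exactness gives
value `= -(#PM)⁻¹ Σ_M P_M(0) ≤ 0`.
-/

set_option linter.dupNamespace false -- `Summit.PneNP.PneNP.…`: summit = sub-problem (D-0017)

namespace Summit.PneNP.PneNP.Theorems.ChebyshevTracialDesignJunta

open Finset Literature.Barriers.PneNP Literature.Combinatorics.SimpleGraph.CycleSpace

/-! ### Part C: junta virtual positivity for exact designs (cell (N1) Theorem)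

For an exact extrapolation design `(C, w)` of degree `D` on the `t`-cuts of `K_n`
(`Literature.Combinatorics.Optimization.IsExactDesign`) and a pair `X : OddSet n → psd`,
`Y : PMatch n → psd` where `X_U` depends only on `U ∩ A` for a window `A` with `|A| ≤ D`
(`2|A| ≤ t + 2`, `2|A| + t ≤ n + 2`; `Y` arbitrary), the design value
`Σ_U Σ_M levelWeight(U,M)·tr(X_U Y_M)` is `≤ 0`: per matching `M` the level sums are `T(n/2;c,i)·P_M(c)`
(junta sum law), `|Q_c| = #PM · T(n/2; c, i)`, so the value is `(#PM)⁻¹ Σ_M Σ_c w_c P_M(c) =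
-(#PM)⁻¹ Σ_M P_M(0) ≤ 0` by exactness. -/

section Design

open Polynomial Matrix Literature.Combinatorics.Optimization

variable {n : ℕ}

/-- Every vertex of the window lies on a window edge: `A ⊆ W`. [folklore] -/
theorem subset_verts_window (M : PMatch n) (A : Finset (Fin n)) :
    A ⊆ (univ : Finset (Fin n)).filter fun v => ∃ e ∈ M.1.filter (fun e => ∃ a ∈ A, a ∈ e), v ∈ e := by
  intro a ha
  obtain ⟨e, he, hae⟩ := M.2.exists_mem (mem_univ a)
  exact mem_filter.2 ⟨mem_univ a, e, mem_filter.2 ⟨he, a, ha, hae⟩, hae⟩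

/-- There are at most `|A|` window edges (each contains a point of `A`, and the edges of a matching are
disjoint). [folklore] -/
theorem card_window_edges_le (M : PMatch n) (A : Finset (Fin n)) :
    (M.1.filter fun e => ∃ a ∈ A, a ∈ e).card ≤ A.card := by
  classical
  let f : Fin n → Sym2 (Fin n) := fun a => if h : ∃ e ∈ M.1, a ∈ e then h.choose else s(a, a)
  refine card_le_card_of_surjOn f fun e he => ?_
  rw [mem_coe, mem_filter] at he
  obtain ⟨heM, a, haA, hae⟩ := he
  refine ⟨a, mem_coe.2 haA, ?_⟩
  have h : ∃ e ∈ M.1, a ∈ e := ⟨e, heM, hae⟩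
  show (if h : ∃ e ∈ M.1, a ∈ e then h.choose else s(a, a)) = e
  rw [dif_pos h]
  exact M.2.unique h.choose_spec.1 heM h.choose_spec.2 hae

/-- A perfect matching of `K_n` has `n/2` edges (`2|M| = n`). [folklore] -/
theorem two_mul_card_pmatch (M : PMatch n) : 2 * M.1.card = n := by
  rw [two_mul_card_eq M.2, card_univ, Fintype.card_fin]

/-- **Per-matching level sums through the Finset-level count**: for `c + 2i = t`,
`Σ_{U : OddSet, |U| = t, cc(U,M) = c} tr(X_U Y_M) = Σ_{U' : #cr = c, #in = i} g_M(U')` with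
`g_M(U') = tr(X_{U'} Y_M)` (read through the odd-cardinality proof). [folklore] -/
theorem sum_oddSet_level_eq (M : PMatch n) {t c i : ℕ} (hci : c + 2 * i = t) {r : ℕ}
    (X : OddSet n → Matrix (Fin r) (Fin r) ℝ) (Y : PMatch n → Matrix (Fin r) (Fin r) ℝ) :
    ∑ U : OddSet n, (if U.1.card = t ∧ cc U M = c then (X U * Y M).trace else 0) =
      ∑ U' ∈ (univ : Finset (Fin n)).powerset.filter (fun U' =>
          (M.1.filter fun e => cutCount U' e = 1).card = c ∧ (M.1.filter fun e => cutCount U' e = 2).card = i),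
        (if h : Odd U'.card then (X ⟨U', h⟩ * Y M).trace else 0) := by
  classical
  -- Finset-level integrand
  set φ : Finset (Fin n) → ℝ := fun U' =>
    if U'.card = t ∧ (M.1.filter fun e => cutCount U' e = 1).card = c then
      (if h : Odd U'.card then (X ⟨U', h⟩ * Y M).trace else 0) else 0 with hφ
  have h1 : ∑ U : OddSet n, (if U.1.card = t ∧ cc U M = c then (X U * Y M).trace else 0) =
      ∑ U : OddSet n, φ U.1 := by
    refine Fintype.sum_congr _ _ fun U => ?_
    rw [hφ]
    simp only [cc_eq_card_filter, dif_pos U.2]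
  have h2 : ∑ U : OddSet n, φ U.1 = ∑ U' ∈ (univ : Finset (Finset (Fin n))).filter (fun U' => Odd U'.card), φ U' :=
    (sum_subtype _ (fun U' => by simp) φ).symm
  have h3 : ∑ U' ∈ (univ : Finset (Finset (Fin n))).filter (fun U' => Odd U'.card), φ U' = ∑ U', φ U' := by
    refine sum_subset (filter_subset _ _) fun U' _ hU' => ?_
    rw [mem_filter, not_and] at hU'
    rw [hφ]
    dsimp only
    rw [dif_neg (hU' (mem_univ _))]
    split_ifs <;> rfl
  rw [h1, h2, h3, hφ, ← sum_filter, powerset_univ]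
  refine sum_congr ?_ fun _ _ => rfl
  ext U'
  simp only [mem_filter, mem_univ, true_and]
  have := card_eq_cr_add_two_mul_in M.2 (subset_univ U')
  constructor
  · rintro ⟨ht, hc⟩; exact ⟨hc, by omega⟩
  · rintro ⟨hc, hi⟩; exact ⟨by omega, hc⟩

/-- **Junta virtual positivity** (cell pnp-psdrank, local virtual positivity lemma (N1)): for an exact
design of degree `D` on the `t`-cuts and a psd pair `(X, Y)` with `X_U` depending only on `U ∩ A`,
`|A| ≤ D` (`2|A| ≤ t + 2`, `2|A| + t ≤ n + 2`), the design value `Σ_U Σ_M W(U,M)·tr(X_U Y_M)` is `≤ 0`.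
No tightness, no dimension restriction, no bound on the weights, and no condition on `Y` is needed.
[folklore] -/
theorem sum_levelWeight_trace_nonpos_of_junta {t T D : ℕ} {Bv : ℝ} {C : Finset ℕ} {w : ℕ → ℝ}
    (hdes : IsExactDesign n t T D Bv C w) {r : ℕ} (A : Finset (Fin n)) (hAD : A.card ≤ D)
    (hAt : 2 * A.card ≤ t + 2) (hAn : 2 * A.card + t ≤ n + 2)
    (X : OddSet n → Matrix (Fin r) (Fin r) ℝ) (Y : PMatch n → Matrix (Fin r) (Fin r) ℝ)
    (hX : ∀ U U' : OddSet n, U.1 ∩ A = U'.1 ∩ A → X U = X U')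
    (hXpsd : ∀ U, (X U).PosSemidef) (hYpsd : ∀ M, (Y M).PosSemidef) :
    ∑ U, ∑ M, levelWeight n t C w U M * (X U * Y M).trace ≤ 0 := by
  classical
  obtain ⟨htodd, -, hTt, hC, -, hexact, -⟩ := hdes
  have htr : ∀ (U : OddSet n) (M : PMatch n), 0 ≤ (X U * Y M).trace := fun U M =>
    (show HasPsdFactorization (fun U M => (X U * Y M).trace) r from ⟨X, Y, hXpsd, hYpsd, fun _ _ => rfl⟩).nonneg U M
  -- Step 1: the value as level sums
  have hval : ∑ U, ∑ M, levelWeight n t C w U M * (X U * Y M).trace =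
      ∑ c ∈ C, w c / ((Qset n t c).card : ℝ) *
        ∑ M : PMatch n, ∑ U : OddSet n, (if U.1.card = t ∧ cc U M = c then (X U * Y M).trace else 0) := by
    calc ∑ U, ∑ M, levelWeight n t C w U M * (X U * Y M).trace
        = ∑ U, ∑ M, ∑ c ∈ C, (if (U, M) ∈ Qset n t c then w c / ((Qset n t c).card : ℝ) * (X U * Y M).trace
            else 0) := by
          refine sum_congr rfl fun U _ => sum_congr rfl fun M _ => ?_
          rw [levelWeight, sum_mul]
          exact sum_congr rfl fun c _ => by split_ifs <;> simp
      _ = ∑ U, ∑ c ∈ C, ∑ M, (if (U, M) ∈ Qset n t c then w c / ((Qset n t c).card : ℝ) * (X U * Y M).trace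
            else 0) := sum_congr rfl fun U _ => sum_comm
      _ = ∑ c ∈ C, ∑ U, ∑ M, (if (U, M) ∈ Qset n t c then w c / ((Qset n t c).card : ℝ) * (X U * Y M).trace
            else 0) := sum_comm
      _ = ∑ c ∈ C, w c / ((Qset n t c).card : ℝ) *
            ∑ M : PMatch n, ∑ U : OddSet n, (if U.1.card = t ∧ cc U M = c then (X U * Y M).trace else 0) := by
          refine sum_congr rfl fun c _ => ?_
          rw [mul_sum, sum_comm]
          refine sum_congr rfl fun M _ => ?_
          rw [mul_sum]
          refine sum_congr rfl fun U _ => ?_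
          simp only [mem_Qset_iff]
          split_ifs <;> simp
  -- Step 2: per matching, the polynomial from the junta sum law
  have hN : ∀ M : PMatch n, M.1.card = n / 2 := fun M => by have := two_mul_card_pmatch M; omega
  have hP : ∀ M : PMatch n, ∃ P : Polynomial ℝ, P.natDegree ≤ D ∧ 0 ≤ P.eval 0 ∧ ∀ c i : ℕ, c + 2 * i = t →
      ∑ U : OddSet n, (if U.1.card = t ∧ cc U M = c then (X U * Y M).trace else 0) =
        (((n / 2).choose (c + i) * (c + i).choose i * 2 ^ c : ℕ) : ℝ) * P.eval (c : ℝ) := by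
    intro M
    set E := M.1.filter (fun e => ∃ a ∈ A, a ∈ e) with hE
    set W := (univ : Finset (Fin n)).filter (fun v => ∃ e ∈ E, v ∈ e) with hW
    have hEM : E ⊆ M.1 := filter_subset _ _
    have hEA : E.card ≤ A.card := card_window_edges_le M A
    have hAW : A ⊆ W := subset_verts_window M A
    obtain ⟨P, hPdeg, hP0, hPval⟩ := junta_sum_law M.2 hEM (t := t) (by omega)
      (by have := two_mul_card_pmatch M; omega)
      (fun U' => if h : Odd U'.card then (X ⟨U', h⟩ * Y M).trace else 0)
      (fun B => if h : ∃ U : OddSet n, U.1.card = t ∧ U.1 ∩ W = B then (X h.choose * Y M).trace else 0)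
      (fun U' _ hU't => by
        have hodd : Odd U'.card := hU't ▸ htodd
        have hex : ∃ U : OddSet n, U.1.card = t ∧ U.1 ∩ W = U' ∩ W := ⟨⟨U', hodd⟩, hU't, rfl⟩
        simp only [dif_pos hodd]
        rw [← hW, dif_pos hex]
        have hXeq : X ⟨U', hodd⟩ = X hex.choose := by
          refine hX _ _ ?_
          have h2 := hex.choose_spec.2
          calc U' ∩ A = (U' ∩ W) ∩ A := by rw [inter_assoc, inter_eq_right.2 hAW]
            _ = (hex.choose.1 ∩ W) ∩ A := by rw [h2]
            _ = hex.choose.1 ∩ A := by rw [inter_assoc, inter_eq_right.2 hAW]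
        rw [hXeq])
      (fun B => by
        split_ifs with h
        · exact htr _ _
        · exact le_refl _)
    refine ⟨P, hPdeg.trans (hEA.trans hAD), hP0, fun c i hci => ?_⟩
    rw [sum_oddSet_level_eq M hci X Y, hPval c i hci, hN M]
  choose P hPdeg hP0 hPval using hP
  -- Step 3: |Q_c| = #PM · T(n/2; c, i)
  have hQ : ∀ c i : ℕ, c + 2 * i = t → ((Qset n t c).card : ℝ) =
      (Fintype.card (PMatch n) : ℝ) * (((n / 2).choose (c + i) * (c + i).choose i * 2 ^ c : ℕ) : ℝ) := by
    intro c i hci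
    have e1 : ((Qset n t c).card : ℝ) =
        ∑ M : PMatch n, ∑ U : OddSet n, (if U.1.card = t ∧ cc U M = c then (1 : ℝ) else 0) := by
      rw [Qset, Finset.card_filter, Nat.cast_sum, Fintype.sum_prod_type, sum_comm]
      refine sum_congr rfl fun M _ => sum_congr rfl fun U _ => ?_
      split_ifs <;> simp
    have e2 : ∀ M : PMatch n, ∑ U : OddSet n, (if U.1.card = t ∧ cc U M = c then (1 : ℝ) else 0) =
        (((n / 2).choose (c + i) * (c + i).choose i * 2 ^ c : ℕ) : ℝ) := by
      intro M
      have key := sum_oddSet_level_eq M hci (r := 1) (fun _ => 1) (fun _ => 1)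
      simp only [Matrix.mul_one, trace_one, Fintype.card_fin, Nat.cast_one, dite_eq_ite] at key
      rw [key]
      have hodd : ∀ U' ∈ (univ : Finset (Fin n)).powerset.filter (fun U' =>
          (M.1.filter fun e => cutCount U' e = 1).card = c ∧ (M.1.filter fun e => cutCount U' e = 2).card = i),
          (if Odd U'.card then (1 : ℝ) else 0) = 1 := by
        intro U' hU'
        rw [mem_filter] at hU'
        have hc := card_eq_cr_add_two_mul_in M.2 (subset_univ U')
        rw [hU'.2.1, hU'.2.2, hci] at hc
        rw [if_pos (hc ▸ htodd)]
      rw [sum_congr rfl hodd, sum_const, nsmul_eq_mul, mul_one, card_filter_cr_in_eq M.2, hN M]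
    rw [e1, Fintype.sum_congr _ _ e2, sum_const, card_univ, nsmul_eq_mul]
  -- Step 4: assemble
  rw [hval]
  have hPM : ∀ c ∈ C, (Fintype.card (PMatch n) : ℝ) ≠ 0 := by
    intro c hc h0
    obtain ⟨p, hp⟩ := (hC c hc).2.2.2
    have : 0 < Fintype.card (PMatch n) := Fintype.card_pos_iff.2 ⟨p.2⟩
    exact absurd h0 (by exact_mod_cast this.ne')
  have hterm : ∀ c ∈ C, w c / ((Qset n t c).card : ℝ) *
      ∑ M : PMatch n, ∑ U : OddSet n, (if U.1.card = t ∧ cc U M = c then (X U * Y M).trace else 0) =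
      (Fintype.card (PMatch n) : ℝ)⁻¹ * ∑ M : PMatch n, w c * (P M).eval (c : ℝ) := by
    intro c hc
    obtain ⟨hcodd, -, hcT, hne⟩ := hC c hc
    have hct : c ≤ t := hcT.trans hTt
    obtain ⟨i, hi⟩ : ∃ i, c + 2 * i = t := by
      obtain ⟨a, ha⟩ := hcodd; obtain ⟨b, hb⟩ := htodd; exact ⟨b - a, by omega⟩
    have hQc := hQ c i hi
    have hQ0 : ((Qset n t c).card : ℝ) ≠ 0 := by exact_mod_cast (card_pos.2 hne).ne'
    have hT0 : (((n / 2).choose (c + i) * (c + i).choose i * 2 ^ c : ℕ) : ℝ) ≠ 0 := by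
      intro h0; rw [h0, mul_zero] at hQc; exact hQ0 hQc
    rw [sum_congr rfl fun M _ => hPval M c i hi, ← mul_sum, hQc, mul_sum, mul_sum, mul_sum]
    refine sum_congr rfl fun M _ => ?_
    field_simp
  rw [sum_congr rfl hterm, ← mul_sum, sum_comm]
  have hinner : ∀ M : PMatch n, ∑ c ∈ C, w c * (P M).eval (c : ℝ) = -(P M).eval 0 :=
    fun M => hexact (P M) (hPdeg M)
  rw [Fintype.sum_congr _ _ hinner]
  exact mul_nonpos_of_nonneg_of_nonpos (inv_nonneg.2 (Nat.cast_nonneg _))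
    (by rw [sum_neg_distrib, neg_nonpos]; exact sum_nonneg fun M _ => hP0 M)

end Design

section Rung

open Matrix Literature.Combinatorics.Optimization

/-- **BC5 rung of the crux `TracialDecayExp20` — junta virtual positivity** (the planner's
`stub_rung_juntaVirtual`, HOME/pnp-psdrank-p1/route/births_scratch.lean, with the junta hypothesis needed
on the cut side only): for every balanced exact design of degree `dq n` on levels `≤ Tq n` (any variation
bound) and every psd pair `(X, Y)` of any dimension `r` with `X_U` depending only on `U ∩ A`, `|A| ≤ dq n`,
the design value `(Σ_U Σ_M W(U,M)·tr(X_U Y_M))/r` is `≤ 0` — tight or not. [folklore] -/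
theorem juntaVirtualPositivity_bal {n t : ℕ} {Bv : ℝ} {C : Finset ℕ} {w : ℕ → ℝ}
    (hdes : IsBalancedDesign n t (Tq n) (dq n) Bv C w) {r : ℕ} (A : Finset (Fin n)) (hA : A.card ≤ dq n)
    (X : OddSet n → Matrix (Fin r) (Fin r) ℝ) (Y : PMatch n → Matrix (Fin r) (Fin r) ℝ)
    (hX : ∀ U U' : OddSet n, U.1 ∩ A = U'.1 ∩ A → X U = X U')
    (hXpsd : ∀ U, (X U).PosSemidef) (hYpsd : ∀ M, (Y M).PosSemidef) :
    (∑ U, ∑ M, levelWeight n t C w U M * (X U * Y M).trace) / r ≤ 0 := by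
  have hsq : dq n ≤ Nat.sqrt n := by unfold dq; exact Nat.sqrt_le_self _
  have hT : Tq n ≤ t := hdes.1.2.2.1
  have htn : 2 * t + 2 ≤ n := hdes.1.2.1
  unfold Tq at hT
  have h1 : 2 * A.card ≤ t + 2 := by omega
  have h2 : 2 * A.card + t ≤ n + 2 := by omega
  exact div_nonpos_iff.2 (Or.inr ⟨sum_levelWeight_trace_nonpos_of_junta hdes.1 A (hA) h1 h2 X Y hX hXpsd hYpsd,
    Nat.cast_nonneg r⟩)

end Rung

end Summit.PneNP.PneNP.Theorems.ChebyshevTracialDesignJunta
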